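/-
Copyright (c) 2026 the pub-hodgecm-mathlib formalisation cell (harness21).  Prover seat hodgecm-mathlib-LH4-p02 (g5), 2026-09-02: the TRACE twin of ★ (J2)
`QuadraticLocalNormFixedRange` — «Tr_{E_w∕F_v} x = x + c_w x» at a non-split place, and the integrality reading that docks the trace dual ∕ inverse different of ★
`RamifiedPlaceTraceDual` (wild base layer of the (D-RAM) column; LH4-plan (g5) WORD #18 (B), F0P3a-p06 (g18) SEAM DEAL #2).
-/
import Literature.NumberTheory.LocalFields.QuadraticLocalNormFixedRange   -- ★ (J2) LH5-p02 (g3): `valued_algebraMap_place`, `natCard_algEquiv_place_eq_two`, `mem_range_algebraMap_place_iff_of_card_eq_two`; brings ★ `SemiLocal.Place`, `algebraPlace`, `decompAlgEquiv`, `isGalois_place`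
import Literature.NumberTheory.Automorphic.RamifiedPlaceTraceDual        -- ★ p851014 F0P3a-p06 (g18): `forall_valued_add_galAdicCompletionMap_mul_le_one_iff` (`𝔇⁻¹ = 𝔭_w^{−d}` in `y + σy` letters); brings `toPlace`, `PlacesOver`
import Mathlib.RingTheory.Trace.Basic                                    -- `trace_eq_sum_automorphisms`, `traceForm_nondegenerate`
import HarnessLib

/-!
# The trace of the local quadratic extension `E_w ∕ F_v` at a non-split place, in `galAdicCompletionMap` currency: `Tr(x) = x + c_w x`
# (Cassels–Fröhlich Ch. VII (Tate) §1.1; Neukirch ANT II (9.6); Serre, *Local Fields* III §3)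

Topic `NumberTheory/LocalFields`; namespace `Literature.NumberTheory.LocalFields`.  THEOREMS ONLY (no definition, no instance, no notation, no named fact, no `sorry`;
axioms ⊆ {propext, Classical.choice, Quot.sound}).  Cell `pub/hodgecm-mathlib` (D-0151), crux H413 = `stmt-HodgeConjecture-24833`, half A line LH4 (dyadic ∕ wild pay-down road);
the TRACE twin of the plumbing brick ★ (J2) `QuadraticLocalNormFixedRange` (`N(x) = x · c_w x`).  USE: the bilinear form `Tr_{L_w∕L⁺_v}(x·y)` is what Mathlib's
`LinearMap.BilinForm.dualSubmodule` ∕ ★ `Literature.LinearAlgebra.DualLatticeIndex` (`[N# : Λ#] = [Λ : N]`, volume rule) are stated for, while the ramified-place kit (★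
`RamifiedPlaceTraceDual`: `Tr 𝔭_w^m = 𝔭_v^{⌊(m+d)∕2⌋}`, `𝒪_w^# = 𝔭_w^{−d}`) speaks `y + σ_w y`; this file is the one `rw` between the two currencies, so the index of the conductor
orders in their trace duals (`[O_j^# : O_j] = q^{d+2j}`, LH4 (B)) can be assembled from ★ parts.  HONEST LABEL: HC_CM is proved only modulo the 7 printed citations (2 remaining:
hLiu418 = stmt-HodgeConjecture-24832, h413 = stmt-HodgeConjecture-24833) until rung 0 closes; this file is unconditional algebra of completions, count-neutral, consumers
none live ((D-RAM) PRINT by D74′; scope audit b4c7662647f1db69 COVERED at v ∣ 2).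

SETTING (= ★ J2).  `E ∕ F` a finite Galois extension of number fields, `v` a finite place of `F`, `w : SemiLocal.Place F E v`, `F_v = v.adicCompletion F`,
`E_w = (w : HeightOneSpectrum (𝓞 E)).adicCompletion E` with the ★ instance `SemiLocal.algebraPlace w`; for `#Gal(E∕F) = 2`, `c ≠ 1`, `c • w = w` (a NON-SPLIT place:
unramified, tame or wild alike) `Gal(E_w∕F_v) = {1, c_w}` (★ `natCard_algEquiv_place_eq_two`, ★ `decompAlgEquiv_apply`).
* §1 (any Galois `E∕F`, any `w`): `traceForm_place_nondegenerate` (★ `isGalois_place` ⇒ separable ⇒ Mathlib `traceForm_nondegenerate`), `valued_algebraMap_place_le_one_iff`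
  (`|ι t|_w ≤ 1 ↔ |t|_v ≤ 1`, from ★ `valued_algebraMap_place` `|ι t| = |t|^e` with `e ≠ 0` read off the same formula at `t = 0`).
* §2 (`#Gal = 2`, non-split `w`): **`algebraMap_trace_place_eq_add_of_card_eq_two`** — `ι(Tr x) = x + c_w x` (Mathlib `trace_eq_sum_automorphisms` + `Finset.sum_pair`);
  `add_galAdicCompletionMap_mem_range_algebraMap`; `algebraMap_traceForm_place_eq_of_card_eq_two` (`ι(Tr(x·y)) = x·y + c_w(x·y)`); the INTEGRALITY READING
  **`valued_trace_place_le_one_iff_of_card_eq_two`** (`|Tr x|_v ≤ 1 ↔ |x + c_w x|_w ≤ 1`) and **`forall_valued_trace_mul_le_one_iff_of_card_eq_two`** — «`y` pairs `𝒪_w` into `𝒪_v`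
  under the trace form» ↔ «`∀ x ∈ 𝒪_w, |x·y + c_w(x·y)| ≤ 1`», the letter of ★ `RamifiedPlaceTraceDual.forall_valued_add_galAdicCompletionMap_mul_le_one_iff` (`𝔇⁻¹ = 𝔭_w^{−d}`).
* §3 CM dress (`L`, `L⁺ = maximalRealSubfield L`, `σ_w = galAdicCompletionMap (IsCMField.complexConj L) hw`): `IsCMField.algebraMap_trace_place_eq_add` etc.  A holder of
  `w : UnitaryGroup.PlacesOver L v` passes `w` ITSELF (same subtype; ★ J2 usage note; `toPlace v w = algebraMap` is ★ `toPlace_eq_algebraMap_place`, `rfl`).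
* §4 THE RAMIFIED-PLACE-KIT DRESS (namespace `Literature.NumberTheory.Automorphic.UnitaryGroup`, frame `(L) (v) (w : PlacesOver L v) (hw) [he]` of ★ `RamifiedPlaceDifferent`,
  `ι = toPlace v w`): `toPlace_trace_eq_add_galAdicCompletionMap` (`ι(Tr y) = y + σ_w y`), `valued_trace_le_one_iff_valued_add_galAdicCompletionMap` and — ONE call over ★ p851014
  §3 — **`forall_valued_trace_mul_le_one_iff_valued_mul_le_one`**: `(∀ x ∈ 𝒪_w, |Tr(x·y)|_v ≤ 1) ↔ |y|·|σ_w τ − τ| ≤ 1`, i.e. `𝒪_w^# = 𝔇_{w∕v}⁻¹ = 𝔭_w^{−d}` for MATHLIB'S trace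
  form at a ramified CM place (the statement ★ `DualLatticeIndex` consumers need; ★ p851014 is cited, not restated: its `y + σy` letter is the right-hand currency here).

## References
* [CasselsFrohlichANT1967] J. W. S. Cassels, A. Fröhlich (eds.), *Algebraic Number Theory* (1967), Ch. VII (J. Tate) §1.1 («`G_w` is the Galois group of `L_w∕K_v`»), Ch. I (Fröhlich) §4
  (trace form, different, dual module).
* [NeukirchANT1999] J. Neukirch, *Algebraic Number Theory* (1999), Ch. II (9.6), Ch. III §2 (2.1)–(2.4) (complementary module `𝔇⁻¹ = {y : Tr(y𝒪) ⊆ 𝔬}`).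
* [Serre1979] J.-P. Serre, *Local Fields*, GTM 67 (1979), Ch. III §3 (codifferent and trace), §4 Prop. 10 (completion).
-/

set_option autoImplicit false

noncomputable section

namespace Literature.NumberTheory.LocalFields

open NumberField IsDedekindDomain
open Literature.NumberTheory.Automorphic Literature.NumberTheory.GaloisRepresentations
open Literature.NumberTheory.GaloisRepresentations.SemiLocal

variable {F : Type} [Field F] [NumberField F] {E : Type} [Field E] [NumberField E] [Algebra F E]
variable {v : HeightOneSpectrum (𝓞 F)}

/-! ## §1 Any Galois `E ∕ F`, any place: non-degenerate trace form; integrality under `F_v → E_w` -/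

/-- **The local trace form `Tr_{E_w∕F_v}(x·y)` is non-degenerate** (`E_w∕F_v` is Galois by ★ `isGalois_place`, hence separable; Mathlib `traceForm_nondegenerate`).
[cite: CasselsFrohlichANT1967, Ch. I §4] [cite: Serre1979, Ch. III §3] -/
theorem traceForm_place_nondegenerate [IsGalois F E] (w : Place F E v) :
    (Algebra.traceForm (v.adicCompletion F) ((w : HeightOneSpectrum (𝓞 E)).adicCompletion E)).Nondegenerate := by
  haveI := finiteDimensional_place (K := F) w
  haveI := isGalois_place (F := F) w
  exact traceForm_nondegenerate _ _

/-- `e(w|v) ≠ 0`, read off ★ `valued_algebraMap_place` at `t = 0` (`0 = 0 ^ e` forces `e ≠ 0`). [cite: CasselsFrohlichANT1967, Ch. II §10] -/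
theorem ramificationIdx'_place_ne_zero (w : Place F E v) : v.asIdeal.ramificationIdx' (w : HeightOneSpectrum (𝓞 E)).asIdeal ≠ 0 := by
  intro h0
  have h := valued_algebraMap_place w (0 : v.adicCompletion F)
  rw [map_zero, map_zero, map_zero, h0, pow_zero] at h
  exact zero_ne_one h

/-- **`|ι t|_w ≤ 1 ↔ |t|_v ≤ 1`** for the structure map `ι : F_v → E_w` (`|ι t| = |t| ^ e`, `e ≠ 0`): `ι t` is integral iff `t` is. [cite: CasselsFrohlichANT1967, Ch. II §10] -/
theorem valued_algebraMap_place_le_one_iff (w : Place F E v) (t : v.adicCompletion F) :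
    Valued.v (algebraMap (v.adicCompletion F) ((w : HeightOneSpectrum (𝓞 E)).adicCompletion E) t) ≤ 1 ↔ Valued.v t ≤ 1 := by
  rw [valued_algebraMap_place w t]
  exact pow_le_one_iff (ramificationIdx'_place_ne_zero w)

/-! ## §2 Quadratic `E ∕ F` at a non-split place: `Tr x = x + c_w x` -/

section Quadratic

variable [IsGalois F E] (hG : Nat.card (E ≃ₐ[F] E) = 2) (w : Place F E v) {c : E ≃ₐ[F] E} (hc : c ≠ 1)
  (hw : c • (w : HeightOneSpectrum (𝓞 E)) = w)

include hG hc hw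

/-- **`Tr_{E_w ∕ F_v}(x) = x + c_w x`** (read in `E_w`) at a non-split place of a quadratic extension: `Gal(E_w∕F_v) = {1, c_w}` and Mathlib's
`trace_eq_sum_automorphisms` — the TRACE twin of ★ `algebraMap_norm_place_eq_mul_of_card_eq_two`. [cite: CasselsFrohlichANT1967, Ch. VII §1.1] [cite: NeukirchANT1999, Ch. II (9.6)] -/
theorem algebraMap_trace_place_eq_add_of_card_eq_two (x : (w : HeightOneSpectrum (𝓞 E)).adicCompletion E) :
    algebraMap (v.adicCompletion F) ((w : HeightOneSpectrum (𝓞 E)).adicCompletion E) (Algebra.trace (v.adicCompletion F) _ x) =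
      x + galAdicCompletionMap (L := E) c hw x := by
  classical
  haveI := finiteDimensional_place (K := F) w
  haveI := isGalois_place (F := F) w
  have hcmem : c ∈ MulAction.stabilizer (E ≃ₐ[F] E) w := MulAction.mem_stabilizer_iff.mpr (Place.ext hw)
  set σ := decompAlgEquiv w ⟨c, hcmem⟩ with hσdef
  have hσ1 : σ ≠ 1 := by
    intro h1
    have hinj := decompHom_injective w (a₁ := ⟨c, hcmem⟩) (a₂ := 1) (by rw [decompHom_apply, decompHom_apply, ← hσdef, h1, ← decompHom_apply, map_one])
    exact hc (congrArg Subtype.val hinj)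
  have hcard : Fintype.card (((w : HeightOneSpectrum (𝓞 E)).adicCompletion E) ≃ₐ[v.adicCompletion F]
      ((w : HeightOneSpectrum (𝓞 E)).adicCompletion E)) = 2 := by
    rw [← Nat.card_eq_fintype_card]; exact natCard_algEquiv_place_eq_two hG w hc hw
  have huniv : ({1, σ} : Finset (((w : HeightOneSpectrum (𝓞 E)).adicCompletion E) ≃ₐ[v.adicCompletion F]
      ((w : HeightOneSpectrum (𝓞 E)).adicCompletion E))) = Finset.univ :=
    Finset.eq_univ_of_card _ (by rw [Finset.card_pair (Ne.symm hσ1), hcard])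
  rw [trace_eq_sum_automorphisms x, ← huniv, Finset.sum_pair (Ne.symm hσ1), AlgEquiv.one_apply, hσdef, decompAlgEquiv_apply]

/-- **`x + c_w x ∈ F_v`**: the local trace of `x ∈ E_w` lies in the base field. [cite: CasselsFrohlichANT1967, Ch. VII §1.1] -/
theorem add_galAdicCompletionMap_mem_range_algebraMap (x : (w : HeightOneSpectrum (𝓞 E)).adicCompletion E) :
    x + galAdicCompletionMap (L := E) c hw x ∈ Set.range (algebraMap (v.adicCompletion F) ((w : HeightOneSpectrum (𝓞 E)).adicCompletion E)) :=
  ⟨Algebra.trace (v.adicCompletion F) _ x, algebraMap_trace_place_eq_add_of_card_eq_two hG w hc hw x⟩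

/-- **The trace FORM: `Tr(x·y) = x·y + c_w(x·y)`** (read in `E_w`; Mathlib `Algebra.traceForm_apply`). [cite: CasselsFrohlichANT1967, Ch. I §4] [cite: Serre1979, Ch. III §3] -/
theorem algebraMap_traceForm_place_eq_of_card_eq_two (x y : (w : HeightOneSpectrum (𝓞 E)).adicCompletion E) :
    algebraMap (v.adicCompletion F) ((w : HeightOneSpectrum (𝓞 E)).adicCompletion E) (Algebra.traceForm (v.adicCompletion F) _ x y) =
      x * y + galAdicCompletionMap (L := E) c hw (x * y) := by
  rw [Algebra.traceForm_apply, algebraMap_trace_place_eq_add_of_card_eq_two hG w hc hw]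

/-- **INTEGRALITY READING: `|Tr x|_v ≤ 1 ↔ |x + c_w x|_w ≤ 1`** — the trace is integral iff its image in `E_w` is (§1 `valued_algebraMap_place_le_one_iff`).
[cite: Serre1979, Ch. III §3] [cite: NeukirchANT1999, Ch. III §2] -/
theorem valued_trace_place_le_one_iff_of_card_eq_two (x : (w : HeightOneSpectrum (𝓞 E)).adicCompletion E) :
    Valued.v (Algebra.trace (v.adicCompletion F) ((w : HeightOneSpectrum (𝓞 E)).adicCompletion E) x) ≤ 1 ↔
      Valued.v (x + galAdicCompletionMap (L := E) c hw x) ≤ 1 := by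
  rw [← valued_algebraMap_place_le_one_iff w, algebraMap_trace_place_eq_add_of_card_eq_two hG w hc hw]

/-- **THE TRACE DUAL IN TWO CURRENCIES**: `y` pairs `𝒪_w` into `𝒪_v` under the trace form (`∀ x ∈ 𝒪_w, |Tr(x·y)|_v ≤ 1`, i.e. `y ∈ 𝒪_w^# = 𝔇⁻¹`) iff
`∀ x ∈ 𝒪_w, |x·y + c_w(x·y)|_w ≤ 1` — the letter of ★ `RamifiedPlaceTraceDual.forall_valued_add_galAdicCompletionMap_mul_le_one_iff` (`𝔇⁻¹ = 𝔭_w^{−d}` at a ramified CM place).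
[cite: NeukirchANT1999, Ch. III §2] [cite: Serre1979, Ch. III §3] -/
theorem forall_valued_trace_mul_le_one_iff_of_card_eq_two (y : (w : HeightOneSpectrum (𝓞 E)).adicCompletion E) :
    (∀ x : (w : HeightOneSpectrum (𝓞 E)).adicCompletion E, Valued.v x ≤ 1 →
        Valued.v (Algebra.trace (v.adicCompletion F) ((w : HeightOneSpectrum (𝓞 E)).adicCompletion E) (x * y)) ≤ 1) ↔
      ∀ x : (w : HeightOneSpectrum (𝓞 E)).adicCompletion E, Valued.v x ≤ 1 → Valued.v (x * y + galAdicCompletionMap (L := E) c hw (x * y)) ≤ 1 := by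
  refine forall_congr' fun x => imp_congr_right fun _ => ?_
  exact valued_trace_place_le_one_iff_of_card_eq_two hG w hc hw (x * y)

end Quadratic

/-! ## §3 CM fields `L ∕ L⁺`: the consumers' spelling `galAdicCompletionMap (IsCMField.complexConj L) hw` -/

section CM

variable (L : Type) [Field L] [NumberField L] [IsCMField L] {v : HeightOneSpectrum (𝓞 ↥(maximalRealSubfield L))}
  (w : Place ↥(maximalRealSubfield L) L v) (hw : IsCMField.complexConj L • (w : HeightOneSpectrum (𝓞 L)) = w)

/-- `#Gal(L ∕ L⁺) = 2` for a CM field `L` (Mathlib: `L ∕ L⁺` is a Galois quadratic extension; private twin of ★ J2's). [folklore] -/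
private theorem IsCMField.natCard_algEquiv_eq_two' : Nat.card (L ≃ₐ[↥(maximalRealSubfield L)] L) = 2 := by
  rw [IsGalois.card_aut_eq_finrank, Algebra.IsQuadraticExtension.finrank_eq_two]

/-- The local trace form of `L_w ∕ L⁺_v` is non-degenerate (any place `w`). [cite: CasselsFrohlichANT1967, Ch. I §4] [cite: Serre1979, Ch. III §3] -/
theorem IsCMField.traceForm_place_nondegenerate :
    (Algebra.traceForm (v.adicCompletion ↥(maximalRealSubfield L)) ((w : HeightOneSpectrum (𝓞 L)).adicCompletion L)).Nondegenerate :=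
  Literature.NumberTheory.LocalFields.traceForm_place_nondegenerate w

include hw

/-- **`Tr_{L_w ∕ L⁺_v}(x) = x + σ_w x`** (read in `L_w`) for a CM field at a non-split place. [cite: CasselsFrohlichANT1967, Ch. VII §1.1] [cite: NeukirchANT1999, Ch. II (9.6)] -/
theorem IsCMField.algebraMap_trace_place_eq_add (x : (w : HeightOneSpectrum (𝓞 L)).adicCompletion L) :
    algebraMap (v.adicCompletion ↥(maximalRealSubfield L)) ((w : HeightOneSpectrum (𝓞 L)).adicCompletion L)
        (Algebra.trace (v.adicCompletion ↥(maximalRealSubfield L)) _ x) =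
      x + galAdicCompletionMap (L := L) (IsCMField.complexConj L) hw x :=
  algebraMap_trace_place_eq_add_of_card_eq_two (IsCMField.natCard_algEquiv_eq_two' L) w (IsCMField.complexConj_ne_one L) hw x

/-- **`x + σ_w x ∈ L⁺_v`** for a CM field at a non-split place. [cite: CasselsFrohlichANT1967, Ch. VII §1.1] -/
theorem IsCMField.add_galAdicCompletionMap_mem_range_algebraMap (x : (w : HeightOneSpectrum (𝓞 L)).adicCompletion L) :
    x + galAdicCompletionMap (L := L) (IsCMField.complexConj L) hw x ∈
      Set.range (algebraMap (v.adicCompletion ↥(maximalRealSubfield L)) ((w : HeightOneSpectrum (𝓞 L)).adicCompletion L)) :=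
  Literature.NumberTheory.LocalFields.add_galAdicCompletionMap_mem_range_algebraMap
    (IsCMField.natCard_algEquiv_eq_two' L) w (IsCMField.complexConj_ne_one L) hw x

/-- **`Tr_{L_w ∕ L⁺_v}(x·y) = x·y + σ_w(x·y)`** for a CM field at a non-split place (the trace FORM). [cite: CasselsFrohlichANT1967, Ch. I §4] [cite: Serre1979, Ch. III §3] -/
theorem IsCMField.algebraMap_traceForm_place_eq (x y : (w : HeightOneSpectrum (𝓞 L)).adicCompletion L) :
    algebraMap (v.adicCompletion ↥(maximalRealSubfield L)) ((w : HeightOneSpectrum (𝓞 L)).adicCompletion L)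
        (Algebra.traceForm (v.adicCompletion ↥(maximalRealSubfield L)) _ x y) =
      x * y + galAdicCompletionMap (L := L) (IsCMField.complexConj L) hw (x * y) :=
  algebraMap_traceForm_place_eq_of_card_eq_two (IsCMField.natCard_algEquiv_eq_two' L) w (IsCMField.complexConj_ne_one L) hw x y

/-- **`|Tr x|_v ≤ 1 ↔ |x + σ_w x|_w ≤ 1`** for a CM field at a non-split place. [cite: Serre1979, Ch. III §3] [cite: NeukirchANT1999, Ch. III §2] -/
theorem IsCMField.valued_trace_place_le_one_iff (x : (w : HeightOneSpectrum (𝓞 L)).adicCompletion L) :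
    Valued.v (Algebra.trace (v.adicCompletion ↥(maximalRealSubfield L)) ((w : HeightOneSpectrum (𝓞 L)).adicCompletion L) x) ≤ 1 ↔
      Valued.v (x + galAdicCompletionMap (L := L) (IsCMField.complexConj L) hw x) ≤ 1 :=
  valued_trace_place_le_one_iff_of_card_eq_two (IsCMField.natCard_algEquiv_eq_two' L) w (IsCMField.complexConj_ne_one L) hw x

/-- **THE TRACE DUAL OF `𝒪_w` IN THE TWO CURRENCIES** for a CM field at a non-split place: `(∀ x ∈ 𝒪_w, |Tr(x·y)|_v ≤ 1) ↔ (∀ x ∈ 𝒪_w, |x·y + σ_w(x·y)|_w ≤ 1)` — so ★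
`RamifiedPlaceTraceDual.forall_valued_add_galAdicCompletionMap_mul_le_one_iff` reads `𝒪_w^# = 𝔇_{w∕v}⁻¹ = 𝔭_w^{−d}` for Mathlib's trace form. [cite: NeukirchANT1999, Ch. III §2] [cite: Serre1979, Ch. III §3] -/
theorem IsCMField.forall_valued_trace_mul_le_one_iff (y : (w : HeightOneSpectrum (𝓞 L)).adicCompletion L) :
    (∀ x : (w : HeightOneSpectrum (𝓞 L)).adicCompletion L, Valued.v x ≤ 1 →
        Valued.v (Algebra.trace (v.adicCompletion ↥(maximalRealSubfield L)) ((w : HeightOneSpectrum (𝓞 L)).adicCompletion L) (x * y)) ≤ 1) ↔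
      ∀ x : (w : HeightOneSpectrum (𝓞 L)).adicCompletion L, Valued.v x ≤ 1 →
        Valued.v (x * y + galAdicCompletionMap (L := L) (IsCMField.complexConj L) hw (x * y)) ≤ 1 :=
  forall_valued_trace_mul_le_one_iff_of_card_eq_two (IsCMField.natCard_algEquiv_eq_two' L) w (IsCMField.complexConj_ne_one L) hw y

end CM

end Literature.NumberTheory.LocalFields

/-! ## §4 The ramified-place-kit dress: `toPlace` ∕ `PlacesOver` letters, and `𝒪_w^# = 𝔭_w^{−d}` for Mathlib's trace form (one call over ★ `RamifiedPlaceTraceDual`)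

INSTANCE NOTE.  For `w : UnitaryGroup.PlacesOver L v` the term `Algebra.trace (v.adicCompletion L⁺) (w.1.adicCompletion L)` elaborates with the `L⁺_v`-algebra structure that instance
resolution finds on `w.1.adicCompletion L` — in this import closure the FLT-packet instance of ★ `AdelicBaseChange.CompletionBaseChange` (`HeightOneSpectrum.Extension`,
`adicCompletionSemialgHom`), which is DEFINITIONALLY EQUAL to ★ `SemiLocal.algebraPlace (w : SemiLocal.Place L⁺ L v)` (`adicCompletionOfLiesOver`) and to `toPlace v w`: the three
`exact`∕`Iff.trans` proofs below are precisely that defeq check, performed by the kernel.  Readers may therefore use §3 (place letters) or §4 (`PlacesOver` letters) interchangeably. -/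

namespace Literature.NumberTheory.Automorphic.UnitaryGroup

open _root_.NumberField _root_.IsDedekindDomain
open Literature.NumberTheory.GaloisRepresentations (SemiLocal.Place)
open Literature.NumberTheory.LocalFields

variable (L : Type) [Field L] [NumberField L] [IsCMField L] (v : HeightOneSpectrum (𝓞 ↥(maximalRealSubfield L)))
  (w : PlacesOver L v) (hw : IsCMField.complexConj L • w.1 = w.1) (he : v.asIdeal.ramificationIdx' w.1.asIdeal ≠ 1)

/-- **`ι(Tr_{L_w ∕ L⁺_v} y) = y + σ_w y`** in the `toPlace` ∕ `PlacesOver` letters of the unitary files (`toPlace v w = algebraMap` of ★ `SemiLocal.algebraPlace`, `rfl` — ★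
`toPlace_eq_algebraMap_place`; the `L⁺_v`-algebra structure on `L_w` is read at the place `(w : SemiLocal.Place L⁺ L v)`, the same subtype). [cite: CasselsFrohlichANT1967, Ch. VII §1.1] -/
theorem toPlace_trace_eq_add_galAdicCompletionMap (y : w.1.adicCompletion L) :
    toPlace v w (Algebra.trace (v.adicCompletion ↥(maximalRealSubfield L))
        (((w : SemiLocal.Place ↥(maximalRealSubfield L) L v) : HeightOneSpectrum (𝓞 L)).adicCompletion L) y) =
      y + galAdicCompletionMap (L := L) (IsCMField.complexConj L) hw y :=
  IsCMField.algebraMap_trace_place_eq_add L (w : SemiLocal.Place ↥(maximalRealSubfield L) L v) hw y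

/-- **`|Tr y|_v ≤ 1 ↔ |y + σ_w y|_w ≤ 1`** in the `PlacesOver` letters. [cite: Serre1979, Ch. III §3] [cite: NeukirchANT1999, Ch. III §2] -/
theorem valued_trace_le_one_iff_valued_add_galAdicCompletionMap (y : w.1.adicCompletion L) :
    Valued.v (Algebra.trace (v.adicCompletion ↥(maximalRealSubfield L))
        (((w : SemiLocal.Place ↥(maximalRealSubfield L) L v) : HeightOneSpectrum (𝓞 L)).adicCompletion L) y) ≤ 1 ↔
      Valued.v (y + galAdicCompletionMap (L := L) (IsCMField.complexConj L) hw y) ≤ 1 :=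
  IsCMField.valued_trace_place_le_one_iff L (w : SemiLocal.Place ↥(maximalRealSubfield L) L v) hw y

include he in
/-- **`𝒪_w^# = 𝔇_{w∕v}⁻¹ = 𝔭_w^{−d}` FOR MATHLIB'S TRACE FORM AT A RAMIFIED CM PLACE**: for a uniformiser `τ` of `L_w` (`D = |σ_w τ − τ| = exp(−d)` the different number) and any `y`,
`(∀ x ∈ 𝒪_w, |Tr_{L_w∕L⁺_v}(x·y)|_v ≤ 1) ↔ |y|·D ≤ 1` — §3's currency bridge composed with ★ `RamifiedPlaceTraceDual.forall_valued_add_galAdicCompletionMap_mul_le_one_iff` (cited, not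
restated: its `x·y + σ(x·y)` letter is exactly the right-hand side of the bridge).  This is the membership test of `LinearMap.BilinForm.dualSubmodule (Algebra.traceForm L⁺_v L_w) 𝒪_w`
that ★ `Literature.LinearAlgebra.DualLatticeIndex` consumers need. [cite: Serre1979, Ch. III §3 Prop. 7, Ch. III §6 Cor. 2] [cite: NeukirchANT1999, Ch. III §2 (2.4)] -/
theorem forall_valued_trace_mul_le_one_iff_valued_mul_le_one {τ : w.1.adicCompletion L} (hτ : Valued.v τ = WithZero.exp (-1 : ℤ)) (y : w.1.adicCompletion L) :
    (∀ x : w.1.adicCompletion L, Valued.v x ≤ 1 →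
        Valued.v (Algebra.trace (v.adicCompletion ↥(maximalRealSubfield L))
          (((w : SemiLocal.Place ↥(maximalRealSubfield L) L v) : HeightOneSpectrum (𝓞 L)).adicCompletion L) (x * y)) ≤ 1) ↔
      Valued.v y * Valued.v (galAdicCompletionMap (L := L) (IsCMField.complexConj L) hw τ - τ) ≤ 1 := by
  exact (IsCMField.forall_valued_trace_mul_le_one_iff L (w : SemiLocal.Place ↥(maximalRealSubfield L) L v) hw y).trans
    (forall_valued_add_galAdicCompletionMap_mul_le_one_iff L v w hw he hτ y)

end Literature.NumberTheory.Automorphic.UnitaryGroup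

end
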